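import Mathlib.Analysis.SpecialFunctions.Trigonometric.Basic
import Mathlib.Analysis.SpecialFunctions.Trigonometric.Series
import HarnessLib

/-!
# HANDOFF — the near-edge profile of a cut-off cosine polynomial as an even power series (rh-explicit, track «HANDOFF», seat prove-2 gen8, ATTEMPT-16 Lemma A3, first half)

HONEST FRAMING. Nothing here bears on the truth of RH. In ATTEMPT-16 (HOME/handoff/prove-2/ATTEMPT-16.md) the dodger is the
cut-off cosine polynomial `F₀(x) = (1/2b)[1 + 2Σ_{k≤K} a_k cos(ℓ_k x)]` on `[−b, b]` (`ℓ_k b = πk`), and the GAIN side of the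
wall-ceiling theorem (Lemma D) is controlled through the near-edge profile
`φ(σ) := (2b/c)·F₀(b − σ) = (1/c)[1 + 2Σ_k (−1)^k a_k cos(ℓ_k σ)]` written as the even power series
`φ(σ) = Σ_n (−1)^n m_n σ^{2n}/(2n)!`, `m_n = (2/c)Σ_k (−1)^k a_k ℓ_k^{2n}` (`n ≥ 1`), `m_0 = (1 + 2Σ_k(−1)^k a_k)/c` (Lemma A3; the
second half of A3 identifies the `m_n` with the Laurent coefficients of the rational function `G` and is not in this file).
THIS FILE proves that expansion in the kernel (`hasSum_cutoffCosProfile`, with `cos_lattice_sub` for the reflection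
`cos(ℓ_k(b − σ)) = (−1)^k cos(ℓ_kσ)`): a finite combination of the cosine series `cos r = Σ_n (−1)^n r^{2n}/(2n)!`
(`Real.hasSum_cos`). No `sorry`, standard axioms.

References: this track (ATTEMPT-16 §2, Lemma A3). Folklore.
-/

set_option linter.dupNamespace false

open Finset

namespace Summit.RiemannHypothesis.RiemannHypothesis.Theorems.Handoff

/-- Reflection at the window edge: `cos(ℓ(b − σ)) = (−1)^k cos(ℓσ)` when `ℓb = kπ` (the lattice condition `ℓ_k b = πk`).
[folklore] -/
theorem cos_lattice_sub {ℓ b σ : ℝ} {k : ℕ} (h : ℓ * b = k * Real.pi) :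
    Real.cos (ℓ * (b - σ)) = (-1) ^ k * Real.cos (ℓ * σ) := by
  rw [mul_sub, h, Real.cos_sub, Real.cos_nat_mul_pi, Real.sin_nat_mul_pi]
  ring

/-- The even power series of a finite cosine combination: for reals `c`, `e_k`, `a_k`, `ℓ_k` (`k < K`) and `σ`,
`(1/c)[1 + 2Σ_k e_k a_k cos(ℓ_k σ)] = Σ_n (−1)^n m_n σ^{2n}/(2n)!` with `m_0 = (1 + 2Σ_k e_k a_k)/c` and
`m_n = (2/c)Σ_k e_k a_k ℓ_k^{2n}` (`n ≥ 1`); in ATTEMPT-16, `e_k = (−1)^k` (after `cos_lattice_sub`) and `c = c_∞`.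
This is Lemma A3 (first half) of ATTEMPT-16: the near-edge profile `φ` of the dodger as the series `Σ(−1)^n m_n σ^{2n}/(2n)!`.
[this track, ATTEMPT-16 Lemma A3] -/
theorem hasSum_cutoffCosProfile (c : ℝ) (K : ℕ) (e a ℓ : ℕ → ℝ) (σ : ℝ) :
    HasSum (fun n : ℕ ↦ (-1) ^ n * ((if n = 0 then (1 + 2 * ∑ k ∈ range K, e k * a k) / c
        else (2 / c) * ∑ k ∈ range K, e k * a k * ℓ k ^ (2 * n))) * σ ^ (2 * n) / (2 * n).factorial)
      ((1 / c) * (1 + 2 * ∑ k ∈ range K, e k * a k * Real.cos (ℓ k * σ))) := by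
  -- each cosine term as a power series in σ
  have hk : ∀ k ∈ range K, HasSum
      (fun n : ℕ ↦ (2 / c) * (e k * a k) * ((-1) ^ n * (ℓ k * σ) ^ (2 * n) / (2 * n).factorial))
      ((2 / c) * (e k * a k) * Real.cos (ℓ k * σ)) :=
    fun k _ ↦ (Real.hasSum_cos (ℓ k * σ)).mul_left _
  have hS := hasSum_sum hk
  -- the constant `1/c` as a series supported at `n = 0`
  have h0 : HasSum (fun n : ℕ ↦ if n = 0 then 1 / c else 0) (1 / c) := hasSum_ite_eq 0 (1 / c)
  have htot := h0.add hS
  have hval : 1 / c + ∑ i ∈ range K, 2 / c * (e i * a i) * Real.cos (ℓ i * σ) =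
      (1 / c) * (1 + 2 * ∑ k ∈ range K, e k * a k * Real.cos (ℓ k * σ)) := by
    have h2 : ∀ i ∈ range K, 2 / c * (e i * a i) * Real.cos (ℓ i * σ) =
        (e i * a i * Real.cos (ℓ i * σ)) * (2 / c) := fun i _ ↦ by ring
    rw [Finset.sum_congr rfl h2, ← Finset.sum_mul]
    generalize (∑ i ∈ range K, e i * a i * Real.cos (ℓ i * σ)) = S
    ring
  rw [hval] at htot
  convert htot using 1
  funext n
  by_cases hn : n = 0
  · subst hn
    simp only [if_true, pow_zero, mul_zero, Nat.factorial_zero, Nat.cast_one, div_one, mul_one, one_mul]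
    have h2 : ∀ i ∈ range K, 2 / c * (e i * a i) = (e i * a i) * (2 / c) := fun i _ ↦ by ring
    rw [Finset.sum_congr rfl h2, ← Finset.sum_mul]
    generalize (∑ i ∈ range K, e i * a i) = S
    ring
  · simp only [hn, if_false, zero_add]
    have h2 : ∀ i ∈ range K, 2 / c * (e i * a i) * ((-1) ^ n * (ℓ i * σ) ^ (2 * n) / (2 * n).factorial) =
        (e i * a i * ℓ i ^ (2 * n)) * ((2 / c) * ((-1) ^ n * σ ^ (2 * n) / (2 * n).factorial)) := by
      intro i _
      rw [mul_pow]
      ring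
    rw [Finset.sum_congr rfl h2, ← Finset.sum_mul]
    generalize (∑ i ∈ range K, e i * a i * ℓ i ^ (2 * n)) = S
    ring

end Summit.RiemannHypothesis.RiemannHypothesis.Theorems.Handoff
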